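import Literature.Computability.AlgebraicComplexity.BD17GaleMultiplicity
import Literature.Computability.AlgebraicComplexity.BD17DescartesRuleRootCounting
import Literature.Computability.AlgebraicComplexity.BD17ReciprocalGaleWronskians
import Mathlib.Analysis.Analytic.Polynomial
import HarnessLib

/-!
# Bihan–Dickenstein 2017, §4.2: `n_𝒜(C)` is the number of roots of `g − 1` in `Δ_P` counted with
# multiplicity — PROVED

F. Bihan, A. Dickenstein, *Descartes' rule of signs for polynomial systems supported on circuits*,
Int. Math. Res. Not. IMRN 2017 (22) 6867–6893 = arXiv:1601.05826 [BihanDickenstein2017], §4.2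
(held text `paper:arxiv-1601.05826`, p0011:L46–64: "`x` is a positive solution of (1.1) if and
only if `y = x^{w_{ᾱ_j}} ∈ Δ_P` satisfies `g(y) = 1`. Moreover, this bijection … preserves the
multiplicities [BS08]. Thus, to bound `n_𝒜(C)` we then have to bound the number of solutions of
`g = 1` over the interval `Δ_P` counted with multiplicities. As we assume that `n_𝒜(C)` is finite,
we get that `g ≢ 1`. … `g(y) = 1` if and only if `y` is a root of the polynomial
`∏_{λ̃_ℓ>0} p_ℓ(y)^{λ̃_ℓ} − ∏_{λ̃_ℓ<0} p_ℓ(y)^{−λ̃_ℓ}`"). THEOREMS (and definitions with bodies)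
ONLY — no named facts; sibling of the statement file `BD17DescartesCircuits.lean` (cell `val-lit`,
row X4-BD17). It combines the multiplicity theorem `BD17.solMultiplicity_eq_rootMultiplicity`
(`BD17GaleMultiplicity.lean`, [BS08] Thm. 2.2) with the set-theoretic correspondence
(`BD17GaleSolutionCorrespondence.lean`) into the COUNT identity used by the proof of Thm. 2.9.

## Main results (normalized Gale basis `B` at `(a, b)`, `det C(a, b) ≠ 0`, `μ = λ` the affine relation)

* `BD17.analyticOrderAt_eval_realPoly`: order of vanishing of a real polynomial = root multiplicity.
* `BD17.galeFun` (`g = ∏ p_ℓ^{μ_ℓ}`), `BD17.galeDen`; `BD17.eval_galePoly_eq_galeDen_mul`: on `Δ_P`,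
  `∏ p^{μ⁺} − ∏ p^{μ⁻} = (∏_{μ<0} p^{−μ}) (g − 1)`; `BD17.rootCountMult_eval_galePoly`: the roots in
  `Δ_P` and the counts with multiplicity of the cleared polynomial and of `g − 1` agree.
* `BD17.injOn_monomial_sub`, `BD17.image_monomial_sub`: `x ↦ x^{w_b − w_a}` is a bijection from the
  positive solutions onto the roots of `g − 1` in `Δ_P`.
* **`BD17.numPosSols_eq_rootCountMult_galeFun`**: `n_𝒜(C) = #{y ∈ Δ_P : g(y) = 1}` counted with
  multiplicity (`BD17.rootCountMult`, the §4.1 count), whenever the cleared polynomial is nonzero;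
  `BD17.numPosSols_eq_rootCountMult_eval` (polynomial form).
* `BD17.finite_posSolutions_of_galePoly_ne_zero`, `BD17.galePoly_ne_zero_of_finite` (under (1.5)):
  "`n_𝒜(C)` finite `⟺ g ≢ 1`"; `BD17.galeInterval_nonempty` (Rem. 2.4 under (1.5)).
* `BD17.exists_isNormalizedGaleBasis`: the basis `P^j, P^i` exists for `rk C = n`, `det C(a,b) ≠ 0`.

What remains for `BD2017_thm_2_9` / `BD2017_prop_2_12`: Rolle with multiplicity
(`finite_zeros_and_rootCountMult_le_deriv_add_one`) applied to `g − 1` on `Δ_P`, the grouping of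
`g'/g = ∑_ℓ λ_ℓ P_{ℓ,2}/p_ℓ` by the classes `K_r` (4.5), Prop. 4.3 (`BD2017_prop_4_3_holds`), the
sign bookkeeping of `P_{ᾱ_r,2}` along the ordering, and Lemma 4.4 (`BD2017_lem_4_4_holds`).

Honest framing: a typed-literature companion (LADDER-VALIANT V1 ideation source, cell `val-lit`);
nothing here bears on VP versus VNP.

## References

* [BihanDickenstein2017] F. Bihan, A. Dickenstein, IMRN 2017 (22) 6867–6893; arXiv:1601.05826, §4.2.
* [BihanSottile2008] F. Bihan, F. Sottile, *Gale duality for complete intersections*, Ann. Inst.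
  Fourier 58 (2008) 877–891; arXiv:0706.3745, Thm. 2.2.
-/

noncomputable section

open Matrix Finset Polynomial

namespace Literature.Computability.AlgebraicComplexity

namespace BD17


/-! ### Real polynomials: order of vanishing = root multiplicity -/

section RealPoly

/-- For a nonzero real polynomial `P`, the order of vanishing of `y ↦ P(y)` at `a` is the root
multiplicity (`P = (Y − a)^m R`, `R(a) ≠ 0`); the dictionary between "roots counted with
multiplicity" of §4.1 (analytic functions) and polynomial roots (p0011:L62–64).
[cite: BihanDickenstein2017, §4.2 (proof of Thm. 2.9)] -/
theorem analyticOrderAt_eval_realPoly {P : ℝ[X]} (hP : P ≠ 0) (a : ℝ) :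
    analyticOrderAt (fun y => P.eval y) a = P.rootMultiplicity a := by
  set m := P.rootMultiplicity a with hm
  set R := P /ₘ (X - C a) ^ m with hR
  have hdec : (X - C a) ^ m * R = P := P.pow_mul_divByMonic_rootMultiplicity_eq a
  have hRa : R.eval a ≠ 0 := eval_divByMonic_pow_rootMultiplicity_ne_zero a hP
  have hfun : (fun y => P.eval y) = ((· - a) ^ m) * fun y => R.eval y := by
    funext y
    conv_lhs => rw [← hdec]
    simp [eval_pow]
  have h1 : AnalyticAt ℝ ((· - a) ^ m) a := by fun_prop
  have h2 : AnalyticAt ℝ (fun y => R.eval y) a := (AnalyticOnNhd.eval_polynomial R) a (Set.mem_univ _)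
  rw [hfun, analyticOrderAt_mul h1 h2, analyticOrderAt_centeredMonomial,
    h2.analyticOrderAt_eq_zero.mpr hRa, add_zero]

/-- `ord_{y=a} P = mult_a(P)` as natural numbers, for `P ≠ 0`. [cite: BihanDickenstein2017, §4.2] -/
theorem analyticOrderNatAt_eval_realPoly {P : ℝ[X]} (hP : P ≠ 0) (a : ℝ) :
    analyticOrderNatAt (fun y => P.eval y) a = P.rootMultiplicity a := by
  rw [analyticOrderNatAt, analyticOrderAt_eval_realPoly hP, ENat.toNat_coe]

end RealPoly

/-! ### The Gale function `g(y) = ∏ p_ℓ(y)^{μ_ℓ}` on `Δ_P` and the cleared polynomial -/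

section GaleFun

variable {n : ℕ}

/-- `g(y) = ∏_ℓ p_ℓ(y)^{μ_ℓ}` (4.4) (integer powers; the print takes `μ = λ̃`).
[cite: BihanDickenstein2017, §4.2 eq. (4.4)] -/
def galeFun (B : Matrix (Fin (n + 2)) (Fin 2) ℝ) (μ : Fin (n + 2) → ℤ) (y : ℝ) : ℝ :=
  ∏ ℓ, galeLin B ℓ y ^ μ ℓ

/-- The denominator `∏_{μ_ℓ<0} p_ℓ(y)^{−μ_ℓ}` clearing `g − 1` (p0011:L62).
[cite: BihanDickenstein2017, §4.2 (proof of Thm. 2.9)] -/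
def galeDen (B : Matrix (Fin (n + 2)) (Fin 2) ℝ) (μ : Fin (n + 2) → ℤ) (y : ℝ) : ℝ :=
  ∏ ℓ ∈ Finset.univ.filter (fun ℓ => μ ℓ < 0), galeLin B ℓ y ^ (-μ ℓ)

/-- The Gale-dual linear functions as units of `ℝ` on `Δ_P`. [cite: BihanDickenstein2017, Rem. 2.4 eq. (2.9)] -/
def galeLinUnit (B : Matrix (Fin (n + 2)) (Fin 2) ℝ) {y : ℝ} (hy : y ∈ galeInterval B)
    (ℓ : Fin (n + 2)) : ℝˣ :=
  Units.mk0 (galeLin B ℓ y) (hy ℓ).ne'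

/-- `∏_ℓ P_ℓ^{μ_ℓ} = ∏_{μ>0} P_ℓ^{μ_ℓ} · ∏_{μ<0} P_ℓ^{μ_ℓ}` in a commutative group.
[cite: BihanDickenstein2017, §2.1 eq. (2.4)] -/
theorem prod_zpow_eq_filter_mul {G : Type*} [CommGroup G] (P : Fin (n + 2) → G)
    (μ : Fin (n + 2) → ℤ) :
    ∏ ℓ, P ℓ ^ μ ℓ = (∏ ℓ ∈ Finset.univ.filter (fun ℓ => 0 < μ ℓ), P ℓ ^ μ ℓ) *
      ∏ ℓ ∈ Finset.univ.filter (fun ℓ => μ ℓ < 0), P ℓ ^ μ ℓ := by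
  rw [Finset.prod_filter, Finset.prod_filter, ← Finset.prod_mul_distrib]
  refine Finset.prod_congr rfl fun ℓ _ => ?_
  by_cases h1 : 0 < μ ℓ
  · have h2 : ¬ μ ℓ < 0 := by omega
    simp [h1, h2]
  · by_cases h2 : μ ℓ < 0
    · simp [h1, h2]
    · have h3 : μ ℓ = 0 := by omega
      simp [h3]

/-- **On `Δ_P`, `∏ p^{μ⁺} − ∏ p^{μ⁻} = (∏_{μ<0} p^{−μ}) · (g − 1)`** ("`g(y) = 1` if and only if `y` is
a root of the polynomial …", p0011:L62). [cite: BihanDickenstein2017, §4.2 (proof of Thm. 2.9)] -/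
theorem eval_galePoly_eq_galeDen_mul (B : Matrix (Fin (n + 2)) (Fin 2) ℝ) (μ : Fin (n + 2) → ℤ)
    {y : ℝ} (hy : y ∈ galeInterval B) :
    (galePoly B μ).eval y = galeDen B μ y * (galeFun B μ y - 1) := by
  set P : Fin (n + 2) → ℝˣ := galeLinUnit B hy with hP
  have hPval : ∀ ℓ, (P ℓ : ℝ) = galeLin B ℓ y := fun ℓ => rfl
  have hev := map_galePoly (evalRingHom y) B μ P (fun ℓ => by
    rw [coe_evalRingHom, eval_linPoly]
    exact (hPval ℓ).symm)
  rw [coe_evalRingHom] at hev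
  have hfun : galeFun B μ y = ((∏ ℓ, P ℓ ^ μ ℓ : ℝˣ) : ℝ) := by
    rw [galeFun, Units.coe_prod]
    exact Finset.prod_congr rfl fun ℓ _ => by rw [Units.val_zpow_eq_zpow_val, hPval]
  have hden : galeDen B μ y =
      ((∏ ℓ ∈ Finset.univ.filter (fun ℓ => μ ℓ < 0), P ℓ ^ (-μ ℓ) : ℝˣ) : ℝ) := by
    rw [galeDen, Units.coe_prod]
    exact Finset.prod_congr rfl fun ℓ _ => by rw [Units.val_zpow_eq_zpow_val, hPval]
  rw [hev, hfun, hden, prod_zpow_eq_filter_mul P μ]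
  have hinv : (∏ ℓ ∈ Finset.univ.filter (fun ℓ => μ ℓ < 0), P ℓ ^ μ ℓ) =
      (∏ ℓ ∈ Finset.univ.filter (fun ℓ => μ ℓ < 0), P ℓ ^ (-μ ℓ))⁻¹ := by
    rw [← Finset.prod_inv_distrib]
    exact Finset.prod_congr rfl fun ℓ _ => by rw [_root_.zpow_neg, inv_inv]
  rw [hinv, Units.val_mul, Units.val_inv_eq_inv_val]
  have hne : ((∏ ℓ ∈ Finset.univ.filter (fun ℓ => μ ℓ < 0), P ℓ ^ (-μ ℓ) : ℝˣ) : ℝ) ≠ 0 :=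
    Units.ne_zero _
  field_simp

/-- `∏_{μ<0} p^{−μ} > 0` on `Δ_P`. [cite: BihanDickenstein2017, §4.2 (proof of Thm. 2.9)] -/
theorem galeDen_pos (B : Matrix (Fin (n + 2)) (Fin 2) ℝ) (μ : Fin (n + 2) → ℤ) {y : ℝ}
    (hy : y ∈ galeInterval B) : 0 < galeDen B μ y :=
  Finset.prod_pos fun ℓ _ => zpow_pos (hy ℓ) _

/-- `g > 0` on `Δ_P`. [cite: BihanDickenstein2017, §4.2 (proof of Thm. 2.9)] -/
theorem galeFun_pos (B : Matrix (Fin (n + 2)) (Fin 2) ℝ) (μ : Fin (n + 2) → ℤ) {y : ℝ}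
    (hy : y ∈ galeInterval B) : 0 < galeFun B μ y :=
  Finset.prod_pos fun ℓ _ => zpow_pos (hy ℓ) _

/-- `p_ℓ` is analytic. [cite: BihanDickenstein2017, §4.1 eq. (4.1)] -/
theorem analyticAt_galeLin (B : Matrix (Fin (n + 2)) (Fin 2) ℝ) (ℓ : Fin (n + 2)) (y : ℝ) :
    AnalyticAt ℝ (galeLin B ℓ) y := by
  have : galeLin B ℓ = fun y => B ℓ 0 + B ℓ 1 * y := funext fun y => rfl
  rw [this]
  fun_prop

/-- `g` is analytic on `Δ_P`. [cite: BihanDickenstein2017, §4.2 (proof of Thm. 2.9)] -/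
theorem analyticOnNhd_galeFun (B : Matrix (Fin (n + 2)) (Fin 2) ℝ) (μ : Fin (n + 2) → ℤ) :
    AnalyticOnNhd ℝ (galeFun B μ) (galeInterval B) := by
  intro y hy
  have : galeFun B μ = fun y => ∏ ℓ ∈ Finset.univ, (galeLin B ℓ ^ μ ℓ) y := by
    funext y
    simp [galeFun]
  rw [this]
  exact Finset.univ.analyticAt_fun_prod fun ℓ _ => (analyticAt_galeLin B ℓ y).zpow (hy ℓ).ne'

/-- `∏_{μ<0} p^{−μ}` is analytic on `Δ_P`. [cite: BihanDickenstein2017, §4.2 (proof of Thm. 2.9)] -/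
theorem analyticOnNhd_galeDen (B : Matrix (Fin (n + 2)) (Fin 2) ℝ) (μ : Fin (n + 2) → ℤ) :
    AnalyticOnNhd ℝ (galeDen B μ) (galeInterval B) := by
  intro y hy
  have : galeDen B μ = fun y => ∏ ℓ ∈ Finset.univ.filter (fun ℓ => μ ℓ < 0),
      (galeLin B ℓ ^ (-μ ℓ)) y := by
    funext y
    simp [galeDen]
  rw [this]
  exact Finset.analyticAt_fun_prod _ fun ℓ _ => (analyticAt_galeLin B ℓ y).zpow (hy ℓ).ne'

/-- **Roots and multiplicities of `g − 1` on `Δ_P` are those of the cleared polynomial.**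
[cite: BihanDickenstein2017, §4.2 (proof of Thm. 2.9)] -/
theorem rootCountMult_eval_galePoly (B : Matrix (Fin (n + 2)) (Fin 2) ℝ) (μ : Fin (n + 2) → ℤ) :
    {y | y ∈ galeInterval B ∧ (galePoly B μ).eval y = 0} =
        {y | y ∈ galeInterval B ∧ galeFun B μ y - 1 = 0} ∧
      rootCountMult (fun y => (galePoly B μ).eval y) (galeInterval B) =
        rootCountMult (fun y => galeFun B μ y - 1) (galeInterval B) := by
  have hcongr := rootCountMult_congr_of_eqOn (isOpen_galeInterval B)
    (f := fun y => (galePoly B μ).eval y) (g := fun y => galeDen B μ y * (galeFun B μ y - 1))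
    (fun y hy => eval_galePoly_eq_galeDen_mul B μ hy)
  have hmul := rootCountMult_mul_left_eq (f := fun y => galeFun B μ y - 1) (g := galeDen B μ)
    (Δ := galeInterval B)
    (fun y hy => ((analyticOnNhd_galeFun B μ) y hy).sub analyticAt_const)
    (analyticOnNhd_galeDen B μ) (fun y hy => (galeDen_pos B μ hy).ne')
  exact ⟨hcongr.1.trans hmul.1, hcongr.2.trans hmul.2⟩

end GaleFun


/-! ### The correspondence `x ↦ y = x^{w_b − w_a}` and the count `n_𝒜(C)` -/

section Count

variable {n : ℕ} {w : Fin (n + 2) → Fin n → ℤ} {C : Matrix (Fin n) (Fin (n + 2)) ℝ}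
  {a b : Fin (n + 2)} {B : Matrix (Fin (n + 2)) (Fin 2) ℝ}

/-- `x^{u − v} = x^u / x^v`. [cite: BihanDickenstein2017, §1 eq. (1.1)] -/
theorem monomial_sub (x : Fin n → ℝ) (hx : ∀ k, x k ≠ 0) (u v : Fin n → ℤ) :
    monomial (u - v) x = monomial u x / monomial v x := by
  rw [monomial_eq_umon x hx, umon_sub, Units.val_mul, Units.val_inv_eq_inv_val,
    ← monomial_eq_umon x hx, ← monomial_eq_umon x hx, div_eq_mul_inv]

/-- **The map `x ↦ y = x^{w_b − w_a}` is injective on positive solutions** ("this bijection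
`x ↦ y = x^{w_{ᾱ_j}}`", p0011:L56). [cite: BihanDickenstein2017, §4.2 (proof of Thm. 2.9)] -/
theorem injOn_monomial_sub (hrk : RankCond w C) (hcirc : IsCircuit w) (hab : a ≠ b)
    (hmin : coeffMinor C a b ≠ 0) (hB : IsNormalizedGaleBasis C a b B) :
    Set.InjOn (fun x : Fin n → ℝ => monomial (w b - w a) x) (posSolutions w C) := by
  intro x hx x' hx' hyy
  have h : GaleLocalData w C a b B x := ⟨hrk, hcirc, hab, hmin, hB, hx⟩
  have h' : GaleLocalData w C a b B x' := ⟨hrk, hcirc, hab, hmin, hB, hx'⟩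
  simp only at hyy
  have hc : 0 < monomial (w a) x / monomial (w a) x' :=
    div_pos (monomial_pos _ h.pos) (monomial_pos _ h'.pos)
  refine (eq_of_monomial_eq_smul w C hrk h.pos h'.pos hc fun ℓ => ?_).2
  have e1 := h.monomial_sub_eq_galeLin ℓ
  have e2 := h'.monomial_sub_eq_galeLin ℓ
  rw [hyy] at e1
  rw [← e2, monomial_sub x h.ne_zero, monomial_sub x' h'.ne_zero] at e1
  have hne := (monomial_pos (w a) h.pos).ne'
  have hne' := (monomial_pos (w a) h'.pos).ne'
  field_simp at e1
  field_simp
  linarith [e1]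

/-- `g(y) = 1` at a root `y ∈ Δ_P` of the cleared polynomial. [cite: BihanDickenstein2017, §4.2] -/
theorem galeFun_eq_one_of_eval_eq_zero (B : Matrix (Fin (n + 2)) (Fin 2) ℝ) (μ : Fin (n + 2) → ℤ)
    {y : ℝ} (hy : y ∈ galeInterval B) (h0 : (galePoly B μ).eval y = 0) : galeFun B μ y = 1 := by
  rw [eval_galePoly_eq_galeDen_mul B μ hy] at h0
  have := (mul_eq_zero.mp h0).resolve_left (galeDen_pos B μ hy).ne'
  linarith

/-- **The image of `x ↦ x^{w_b − w_a}` is the set of roots of `g − 1` in `Δ_P`** ("`x` is a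
positive solution of (1.1) if and only if `y = x^{w_{ᾱ_j}} ∈ Δ_P` satisfies `g(y) = 1`",
p0011:L55–56). [cite: BihanDickenstein2017, §4.2 (proof of Thm. 2.9)] -/
theorem image_monomial_sub (hrk : RankCond w C) (hcirc : IsCircuit w) (hab : a ≠ b)
    (hmin : coeffMinor C a b ≠ 0) (hB : IsNormalizedGaleBasis C a b B) :
    (fun x : Fin n → ℝ => monomial (w b - w a) x) '' posSolutions w C =
      {y | y ∈ galeInterval B ∧ (galePoly B (affRel w)).eval y = 0} := by
  ext y
  simp only [Set.mem_image, Set.mem_setOf_eq]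
  constructor
  · rintro ⟨x, hx, rfl⟩
    have h : GaleLocalData w C a b B x := ⟨hrk, hcirc, hab, hmin, hB, hx⟩
    exact ⟨h.mem_galeInterval, h.eval_galePoly_yPt (affRel w) (expMatrix_mulVec_affRel w)⟩
  · rintro ⟨hy, h0⟩
    have hg := galeFun_eq_one_of_eval_eq_zero B (affRel w) hy h0
    set v : Fin (n + 2) → ℝ := fun ℓ => galeLin B ℓ y with hv
    have hvpos : ∀ ℓ, 0 < v ℓ := hy
    have hvker : C.mulVec v = 0 := by
      have : v = (fun ℓ => B ℓ 0) + y • fun ℓ => B ℓ 1 := by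
        funext ℓ
        simp [hv, galeLin, mul_comm]
      rw [this, Matrix.mulVec_add, Matrix.mulVec_smul, hB.mulVec_col 0, hB.mulVec_col 1, smul_zero,
        add_zero]
    have hN : ∑ ℓ, (affRel w ℓ : ℝ) * Real.log (v ℓ) = 0 := by
      have hlog : Real.log (galeFun B (affRel w) y) = ∑ ℓ, (affRel w ℓ : ℝ) * Real.log (v ℓ) := by
        rw [galeFun, Real.log_prod (fun ℓ _ => (zpow_pos (hy ℓ) _).ne')]
        exact Finset.sum_congr rfl fun ℓ _ => Real.log_zpow _ _
      rw [← hlog, hg, Real.log_one]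
    obtain ⟨x, hx, c, hc, hcx⟩ := exists_solution_of_sum_log_eq_zero w C hrk hcirc hvpos hvker hN
    refine ⟨x, hx, ?_⟩
    have ha := hcx a
    have hb := hcx b
    have hva : v a = 1 := by simp [hv, galeLin, hB.left_fst, hB.left_snd]
    have hvb : v b = y := by simp [hv, galeLin, hB.right_fst, hB.right_snd]
    rw [hva] at ha
    rw [hvb] at hb
    have hxne : ∀ k, x k ≠ 0 := fun k => (hx.1 k).ne'
    rw [monomial_sub x hxne, hb, div_eq_iff (monomial_pos _ hx.1).ne']
    calc monomial (w b) x = 1 * monomial (w b) x := (one_mul _).symm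
      _ = c * monomial (w a) x * monomial (w b) x := by rw [← ha]
      _ = c * monomial (w b) x * monomial (w a) x := by ring

/-- **`n_𝒜(C)` is the number of roots of the cleared polynomial in `Δ_P`, counted with
multiplicity** (the set half of the correspondence plus `solMultiplicity_eq_rootMultiplicity`).
[cite: BihanDickenstein2017, §4.2 (proof of Thm. 2.9); BihanSottile2008, Thm. 2.2] -/
theorem numPosSols_eq_rootCountMult_eval (hrk : RankCond w C) (hcirc : IsCircuit w) (hab : a ≠ b)
    (hmin : coeffMinor C a b ≠ 0) (hB : IsNormalizedGaleBasis C a b B)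
    (hG : galePoly B (affRel w) ≠ 0) :
    numPosSols w C = rootCountMult (fun y => (galePoly B (affRel w)).eval y) (galeInterval B) := by
  unfold numPosSols rootCountMult
  rw [← image_monomial_sub hrk hcirc hab hmin hB, finsum_mem_image (injOn_monomial_sub hrk hcirc hab hmin hB)]
  refine finsum_mem_congr rfl fun x hx => ?_
  rw [analyticOrderNatAt_eval_realPoly hG]
  exact solMultiplicity_eq_rootMultiplicity_affRel w C hrk hcirc hab hmin hB hx hG

/-- **`n_𝒜(C)` = the number of roots of `g − 1` in `Δ_P` counted with multiplicity** ("to bound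
`n_𝒜(C)` we then have to bound the number of solutions of `g = 1` over the interval `Δ_P` counted
with multiplicities", p0011:L57–58), `g = ∏ p_ℓ^{λ_ℓ}`.
[cite: BihanDickenstein2017, §4.2 (proof of Thm. 2.9); BihanSottile2008, Thm. 2.2] -/
theorem numPosSols_eq_rootCountMult_galeFun (hrk : RankCond w C) (hcirc : IsCircuit w) (hab : a ≠ b)
    (hmin : coeffMinor C a b ≠ 0) (hB : IsNormalizedGaleBasis C a b B)
    (hG : galePoly B (affRel w) ≠ 0) :
    numPosSols w C = rootCountMult (fun y => galeFun B (affRel w) y - 1) (galeInterval B) := by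
  rw [numPosSols_eq_rootCountMult_eval hrk hcirc hab hmin hB hG, (rootCountMult_eval_galePoly B _).2]

/-- If the cleared polynomial is nonzero, there are finitely many positive solutions.
[cite: BihanDickenstein2017, §4.2 (proof of Thm. 2.9)] -/
theorem finite_posSolutions_of_galePoly_ne_zero (hrk : RankCond w C) (hcirc : IsCircuit w)
    (hab : a ≠ b) (hmin : coeffMinor C a b ≠ 0) (hB : IsNormalizedGaleBasis C a b B)
    (hG : galePoly B (affRel w) ≠ 0) : (posSolutions w C).Finite := by
  refine Set.Finite.of_finite_image ?_ (injOn_monomial_sub hrk hcirc hab hmin hB)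
  rw [image_monomial_sub hrk hcirc hab hmin hB]
  exact (Polynomial.finite_setOf_isRoot hG).subset fun y hy => hy.2

/-- The normalized basis is a Gale dual of `C` (standalone form). [cite: BihanDickenstein2017, §4.2] -/
theorem IsNormalizedGaleBasis.isGaleDual (hB : IsNormalizedGaleBasis C a b B) (hrk : C.rank = n) :
    IsGaleDual C B := by
  have hu : C.mulVec (fun ℓ => B ℓ 0) = 0 := hB.mulVec_col 0
  have he : C.mulVec (fun ℓ => B ℓ 1) = 0 := hB.mulVec_col 1
  have hu0 : (fun ℓ => B ℓ 0) ≠ 0 := by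
    intro h0
    have := congr_fun h0 a
    rw [hB.left_fst] at this
    exact one_ne_zero this
  have hespan : (fun ℓ => B ℓ 1) ∉ Submodule.span ℝ {fun ℓ => B ℓ 0} := by
    intro hmem
    rw [Submodule.mem_span_singleton] at hmem
    obtain ⟨c, hc⟩ := hmem
    have hcb := congr_fun hc b
    simp only [Pi.smul_apply, smul_eq_mul, hB.right_fst, hB.right_snd, mul_zero] at hcb
    exact zero_ne_one hcb
  have hG := isGaleDual_pair C hrk hu hu0 he hespan
  have hBeq : (Matrix.of fun j t => (![fun ℓ => B ℓ 0, fun ℓ => B ℓ 1] : Fin 2 → Fin (n + 2) → ℝ) t j)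
      = B := by
    ext j t
    fin_cases t <;> simp
  rw [hBeq] at hG
  exact hG

/-- Under (1.5), `Δ_P ≠ ∅` for the normalized basis (the positive kernel vector `u` gives
`y = u_b/u_a`). [cite: BihanDickenstein2017, Rem. 2.4] -/
theorem galeInterval_nonempty (hB : IsNormalizedGaleBasis C a b B) (hrk : C.rank = n)
    (hcone : PosConeCond C) : (galeInterval B).Nonempty := by
  obtain ⟨u, hupos, hu⟩ := hcone
  obtain ⟨α, β, hαβ⟩ := exists_coeffs_of_isGaleDual (hB.isGaleDual hrk) hu
  have ha := hαβ a
  have hb := hαβ b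
  rw [hB.left_fst, hB.left_snd] at ha
  rw [hB.right_fst, hB.right_snd] at hb
  simp only [mul_one, mul_zero, add_zero, zero_add] at ha hb
  refine ⟨β / α, fun ℓ => ?_⟩
  have hα : 0 < α := by rw [← ha]; exact hupos a
  have : galeLin B ℓ (β / α) = u ℓ / α := by
    rw [galeLin, hαβ ℓ]
    field_simp
  rw [this]
  exact div_pos (hupos ℓ) hα

/-- **Finiteness of `n_𝒜(C)` forces `g ≢ 1`**: if the cleared polynomial vanished identically,
every point of the (nonempty, open) Gale interval would give a positive solution.
[cite: BihanDickenstein2017, §4.2 (proof of Thm. 2.9): "As we assume that `n_𝒜(C)` is finite, we get that `g ≢ 1`"] -/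
theorem galePoly_ne_zero_of_finite (hrk : RankCond w C) (hcirc : IsCircuit w) (hab : a ≠ b)
    (hmin : coeffMinor C a b ≠ 0) (hB : IsNormalizedGaleBasis C a b B) (hcone : PosConeCond C)
    (hfin : (posSolutions w C).Finite) : galePoly B (affRel w) ≠ 0 := by
  intro hG
  have himg := image_monomial_sub hrk hcirc hab hmin hB
  rw [hG] at himg
  simp only [eval_zero, and_true] at himg
  have hfinI : (galeInterval B).Finite := by
    have : (galeInterval B) = (fun x : Fin n → ℝ => monomial (w b - w a) x) '' posSolutions w C := by
      rw [himg]
      rfl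
    rw [this]
    exact hfin.image _
  obtain ⟨y₀, hy₀⟩ := galeInterval_nonempty hB hrk.2 hcone
  obtain ⟨ε, hε, hball⟩ := Metric.isOpen_iff.mp (isOpen_galeInterval B) y₀ hy₀
  have hinf : (Metric.ball y₀ ε).Infinite := by
    rw [Real.ball_eq_Ioo]
    exact Set.Ioo_infinite (by linarith)
  exact hinf (hfinI.subset hball)

end Count

/-! ### Existence of the normalized Gale basis -/

section Basis

variable {n : ℕ}

/-- `C v = ∑_ℓ v_ℓ C_ℓ` (columns). [cite: BihanDickenstein2017, Lemma 2.2 (proof)] -/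
theorem mulVec_eq_sum_smul_cols (C : Matrix (Fin n) (Fin (n + 2)) ℝ) (v : Fin (n + 2) → ℝ) :
    C.mulVec v = ∑ ℓ, v ℓ • Cᵀ ℓ := by
  funext i
  simp [Matrix.mulVec, dotProduct, Finset.sum_apply, mul_comm]

/-- **The normalized Gale basis exists** for `rk C = n` and `det C(a, b) ≠ 0`: the projection of
`Ker(C)` to the coordinates `(a, b)` is injective (a kernel vector supported on `[n+2] ∖ {a,b}`
vanishes, the columns there being independent), hence bijective (both spaces have dimension `2`);
these are the vectors `P^j, P^i` of p0011:L28–32. [cite: BihanDickenstein2017, §4.2 (before the proof of Thm. 2.9)] -/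
theorem exists_isNormalizedGaleBasis (C : Matrix (Fin n) (Fin (n + 2)) ℝ) (hrk : C.rank = n)
    {a b : Fin (n + 2)} (hab : a ≠ b) (hmin : coeffMinor C a b ≠ 0) :
    ∃ B : Matrix (Fin (n + 2)) (Fin 2) ℝ, IsNormalizedGaleBasis C a b B := by
  set V := LinearMap.ker C.mulVecLin with hV
  -- the projection to the coordinates `a, b`
  set π : V →ₗ[ℝ] (Fin 2 → ℝ) :=
    { toFun := fun v => ![(v : Fin (n + 2) → ℝ) a, (v : Fin (n + 2) → ℝ) b]
      map_add' := fun v v' => by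
        funext t; fin_cases t <;> simp
      map_smul' := fun c v => by
        funext t; fin_cases t <;> simp } with hπ
  have hind : LinearIndepOn ℝ Cᵀ
      (↑((Finset.univ : Finset (Fin (n + 2))) \ {a, b}) : Set (Fin (n + 2))) :=
    (coeffMinor_ne_zero_iff C hab).mp hmin
  have hinj : Function.Injective π := by
    rw [← LinearMap.ker_eq_bot, LinearMap.ker_eq_bot']
    intro v hv
    have hva : (v : Fin (n + 2) → ℝ) a = 0 := by
      have := congr_fun hv 0; simpa [hπ] using this
    have hvb : (v : Fin (n + 2) → ℝ) b = 0 := by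
      have := congr_fun hv 1; simpa [hπ] using this
    have hker : C.mulVec (v : Fin (n + 2) → ℝ) = 0 := LinearMap.mem_ker.mp v.2
    rw [mulVec_eq_sum_smul_cols, sum_eq_pair_add_sum_pairCompl hab, hva, hvb, zero_smul, zero_smul,
      zero_add, zero_add] at hker
    -- independence of the columns on `S`
    have hli : LinearIndependent ℝ (fun t : Fin n => Cᵀ (pairCompl hab t)) := by
      have hcomp : (fun t : Fin n => Cᵀ (pairCompl hab t)) =
          (fun s : (↑((Finset.univ : Finset (Fin (n + 2))) \ {a, b}) : Set (Fin (n + 2))) => Cᵀ s) ∘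
            fun t => ⟨pairCompl hab t, by exact_mod_cast pairCompl_mem hab t⟩ := by
        funext t; rfl
      rw [hcomp]
      exact hind.comp _ fun t t' htt' => (pairCompl hab).injective (by
        have := congrArg Subtype.val htt'; exact this)
    have hzero := (linearIndependent_iff'.mp hli) Finset.univ (fun t => (v : Fin (n + 2) → ℝ)
      (pairCompl hab t)) hker
    apply Subtype.ext
    funext ℓ
    rcases eq_or_eq_or_exists_pairCompl hab ℓ with rfl | rfl | ⟨t, rfl⟩
    · exact hva
    · exact hvb
    · exact hzero t (Finset.mem_univ t)
  have hdim : Module.finrank ℝ V = Module.finrank ℝ (Fin 2 → ℝ) := by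
    rw [hV, finrank_ker_mulVecLin_eq_two C hrk, Module.finrank_fin_fun]
  have hsurj : Function.Surjective π :=
    (LinearMap.injective_iff_surjective_of_finrank_eq_finrank hdim).mp hinj
  obtain ⟨v0, hv0⟩ := hsurj ![1, 0]
  obtain ⟨v1, hv1⟩ := hsurj ![0, 1]
  have hv0a : (v0 : Fin (n + 2) → ℝ) a = 1 := by have := congr_fun hv0 0; simpa [hπ] using this
  have hv0b : (v0 : Fin (n + 2) → ℝ) b = 0 := by have := congr_fun hv0 1; simpa [hπ] using this
  have hv1a : (v1 : Fin (n + 2) → ℝ) a = 0 := by have := congr_fun hv1 0; simpa [hπ] using this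
  have hv1b : (v1 : Fin (n + 2) → ℝ) b = 1 := by have := congr_fun hv1 1; simpa [hπ] using this
  have hk0 : C.mulVec (v0 : Fin (n + 2) → ℝ) = 0 := LinearMap.mem_ker.mp v0.2
  have hk1 : C.mulVec (v1 : Fin (n + 2) → ℝ) = 0 := LinearMap.mem_ker.mp v1.2
  refine ⟨Matrix.of fun ℓ t => (![(v0 : Fin (n + 2) → ℝ), (v1 : Fin (n + 2) → ℝ)] :
    Fin 2 → Fin (n + 2) → ℝ) t ℓ, ⟨?_, ?_, ?_, ?_, ?_⟩⟩
  · intro t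
    fin_cases t
    · simpa using hk0
    · simpa using hk1
  · simpa using hv0a
  · simpa using hv1a
  · simpa using hv0b
  · simpa using hv1b

end Basis

end BD17

end Literature.Computability.AlgebraicComplexity
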